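import Summits.CriticalPhenomena.PercolationContinuityZ3.Theorems.PercNearOneGluingNoHeavyLowerTailSahiCTCLadderThreeRowThreeFacts
import Summits.CriticalPhenomena.PercolationContinuityZ3.Theorems.PercNearOneGluingNoHeavyLowerTailSahiCTCLadderThreeRowThreeArith
import HarnessLib

/-!
# `NoHeavyLowerTail` (crux stmt-CriticalPhenomena-4575), P3 lane: the row `#dbl = 3` of `(L_3)` with `D` common, `τ ≥ 18`

Support file (seat `prim-l12-p3`, gen 26; `--supports stmt-CriticalPhenomena-4575`).  Paper proof `prim-l12-p3/ROW3-PROOF-g26.md` §5.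
THEOREM (`coeff_ladder_three_rowThree_nonneg_alpha`): for 3-live up-sets `𝒳, 𝒵` and a profile `m ≤ 2` with doubled set `D`, `#D = 3`,
`D ∈ 𝒳 ∩ 𝒵` and `τ = #(lev m 1) ≥ 18`:  `[m](e_3·H − Θ_2·e_{≥3}·GF(W_3)) ≥ 0`.  Case I (every family triangle-type) is
`coeff_ladder_three_rowThree_nonneg_of_tri`; otherwise the per-family data (`…RowThreeFacts`, `…RowThreeDegree`, `…RowThreeSums`,
`…RowThreeChain`) are fed to the arithmetic certificates `rowThree_arith_k1/k2/k3` (`…RowThreeArith`) according to which families are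
degree-type.  (The range `3 ≤ τ ≤ 17` of the paper proof is an exhaustive scan and is not formalised here.)  Nothing is asserted about the crux.
-/

namespace Summit.CriticalPhenomena.PercolationContinuityZ3.Theorems.SahiCTCForms

open Finset MvPolynomial SahiCTCGenFun SahiCTCWeightedLYM

variable {α : Type*} [DecidableEq α] [Fintype α]

section RowThreeCaseII
variable {𝒳 𝒵 : Finset (Finset α)}

omit [Fintype α] in
/-- Cap on the Q-graph: `#qset m d + 1 ≤ C(τ,2) + [d + a + b ∈ 𝒳 ∩ 𝒵]` for a pair `a ≠ b` of `T`. [this work] -/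
theorem card_qset_le {m : α →₀ ℕ} (d : α) {a b : α} (ha : a ∈ lev m 1) (hb : b ∈ lev m 1) (hab : a ≠ b) :
    #(qset 𝒳 𝒵 m d) + 1 ≤ (#(lev m 1)).choose 2 + if insert d {a, b} ∈ 𝒳 ∧ insert d {a, b} ∈ 𝒵 then 1 else 0 := by
  have habm : ({a, b} : Finset α) ∈ (lev m 1).powersetCard 2 :=
    mem_powersetCard.2 ⟨insert_subset ha (singleton_subset_iff.2 hb), card_pair hab⟩
  unfold qset
  split_ifs with h
  · have := card_filter_le ((lev m 1).powersetCard 2) (fun Q => insert d Q ∈ 𝒳 ∧ insert d Q ∈ 𝒵)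
    rw [card_powersetCard] at this; omega
  · have hsub : (((lev m 1).powersetCard 2).filter fun Q => insert d Q ∈ 𝒳 ∧ insert d Q ∈ 𝒵) ⊆
        ((lev m 1).powersetCard 2).erase {a, b} := fun Q hQ => by
      obtain ⟨hQ1, hQ2⟩ := mem_filter.1 hQ
      refine mem_erase.2 ⟨fun hQab => ?_, hQ1⟩
      subst hQab; exact h hQ2
    have := card_le_card hsub
    rw [card_erase_of_mem habm, card_powersetCard] at this
    have hpos : 1 ≤ (#(lev m 1)).choose 2 := by
      have := card_pos.2 ⟨_, habm⟩; rwa [card_powersetCard] at this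
    omega

/-- **Row `#dbl = 3` of `(L_3)` with `D` common, `τ ≥ 18`** (ROW3-PROOF §5). [this work] -/
theorem coeff_ladder_three_rowThree_nonneg_alpha (h𝒳 : IsUpperSet (𝒳 : Set (Finset α))) (h𝒵 : IsUpperSet (𝒵 : Set (Finset α)))
    (hX3 : ∀ S ∈ 𝒳, 3 ≤ #S) (hZ3 : ∀ S ∈ 𝒵, 3 ≤ #S) {m : α →₀ ℕ} (hm : ∀ i, m i ≤ 2) (hD : #(dbl m) = 3)
    (hτ : 18 ≤ #(lev m 1)) (hDX : dbl m ∈ 𝒳) (hDZ : dbl m ∈ 𝒵) :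
    0 ≤ (ee 3 * (PiP * gf (𝒳 ∩ 𝒵) - gf 𝒳 * gf 𝒵) -
      gf (bySize (· ≤ 3 - 1) : Finset (Finset α)) * gf (bySize (3 ≤ ·) : Finset (Finset α)) *
        gf ((𝒳 ∩ 𝒵).filter fun S => #S = 3)).coeff m := by
  -- the three doubled points
  obtain ⟨d₁, d₂, d₃, h12, h13, h23, hDeq⟩ := card_eq_three.1 hD
  have hd₁ : d₁ ∈ dbl m := by rw [hDeq]; simp
  have hd₂ : d₂ ∈ dbl m := by rw [hDeq]; simp
  have hd₃ : d₃ ∈ dbl m := by rw [hDeq]; simp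
  have he₁₂ : d₂ ∈ (dbl m).erase d₁ := mem_erase.2 ⟨h12.symm, hd₂⟩
  have he₁₃ : d₃ ∈ (dbl m).erase d₁ := mem_erase.2 ⟨h13.symm, hd₃⟩
  have he₂₁ : d₁ ∈ (dbl m).erase d₂ := mem_erase.2 ⟨h12, hd₁⟩
  have he₂₃ : d₃ ∈ (dbl m).erase d₂ := mem_erase.2 ⟨h23.symm, hd₃⟩
  have he₃₁ : d₁ ∈ (dbl m).erase d₃ := mem_erase.2 ⟨h13, hd₁⟩
  have he₃₂ : d₂ ∈ (dbl m).erase d₃ := mem_erase.2 ⟨h23, hd₂⟩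
  -- Case I?
  by_cases hall : 2 ≤ #(csetL2 𝒳 𝒵 m d₁ d₂ ∩ csetL2 𝒳 𝒵 m d₁ d₃) ∧ 2 ≤ #(csetL2 𝒳 𝒵 m d₂ d₁ ∩ csetL2 𝒳 𝒵 m d₂ d₃) ∧
      2 ≤ #(csetL2 𝒳 𝒵 m d₃ d₁ ∩ csetL2 𝒳 𝒵 m d₃ d₂)
  · refine coeff_ladder_three_rowThree_nonneg_of_tri h𝒳 h𝒵 hX3 hZ3 hm hD (by omega) hDX hDZ fun d hd x hx x' hx' hxx' => ?_
    obtain ⟨hA, hB, hC⟩ := hall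
    rw [hDeq] at hd hx hx'
    simp only [mem_erase, mem_insert, mem_singleton] at hd hx hx'
    obtain ⟨hxd, hx⟩ := hx
    obtain ⟨hx'd, hx'⟩ := hx'
    rcases hd with rfl | rfl | rfl <;> rcases hx with rfl | rfl | rfl <;> rcases hx' with rfl | rfl | rfl <;>
      first | exact absurd rfl hxd | exact absurd rfl hx'd | exact absurd rfl hxx' | exact hA | exact hB | exact hC |
        (rw [inter_comm]; first | exact hA | exact hB | exact hC)
  -- the common setting
  set W := (𝒳 ∩ 𝒵).filter fun S => #S = 3 with hWdef
  have hW3 : ∀ w ∈ W, #w = 3 := fun w hw => (mem_filter.1 hw).2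
  have hWsub : ∀ w ∈ W, w ∈ 𝒳 ∧ w ∈ 𝒵 := fun w hw => mem_inter.1 (mem_filter.1 hw).1
  have hDW : dbl m ∈ W := mem_filter.2 ⟨mem_inter.2 ⟨hDX, hDZ⟩, hD⟩
  have hDT : Disjoint (dbl m) (lev m 1) := disjoint_dbl_lev_one m
  rw [coeff_sub, sub_nonneg]
  refine (coeff_chargeT_rowThree_le hm hD (by omega) W hW3).trans
    (le_trans ?_ (cubes_le_coeff_ee_mul_harris_rowThree h𝒳 h𝒵 hm hD))
  rw [if_pos hDW]
  set τ := #(lev m 1) with hτdef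
  -- sums over D = {d₁,d₂,d₃}
  have hn₁ : d₁ ∉ ({d₂, d₃} : Finset α) := by simp [h12, h13]
  have hn₂ : d₂ ∉ ({d₃} : Finset α) := by simp [h23]
  have hsumD : ∀ f : α → ℤ, ∑ d ∈ dbl m, f d = f d₁ + f d₂ + f d₃ := fun f => by
    rw [hDeq, sum_insert hn₁, sum_insert hn₂, sum_singleton]; ring
  have hsumDn : ∀ f : α → ℕ, ∑ d ∈ dbl m, f d = f d₁ + f d₂ + f d₃ := fun f => by
    rw [hDeq, sum_insert hn₁, sum_insert hn₂, sum_singleton]; ring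
  -- the restriction cube: any two points of T
  obtain ⟨a, haT⟩ : (lev m 1).Nonempty := card_pos.1 (by omega)
  obtain ⟨b, hb⟩ : ((lev m 1).erase a).Nonempty := card_pos.1 (by rw [card_erase_of_mem haT]; omega)
  have hab : a ≠ b := (ne_of_mem_erase hb).symm
  have hbT : b ∈ lev m 1 := mem_of_mem_erase hb
  have haD : a ∉ dbl m := fun h => disjoint_left.1 hDT h haT
  have hbD : b ∉ dbl m := fun h => disjoint_left.1 hDT h hbT
  have hKs : insert a (insert b (dbl m)) ⊆ dbl m ∪ lev m 1 :=
    insert_subset (mem_union_right _ haT) (insert_subset (mem_union_right _ hbT) subset_union_left)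
  have hbase := four_le_kap_base h𝒳 h𝒵 hX3 hZ3 hD hab haD hbD hDX hDZ
  have hmono := kap_le_kap_of_subset h𝒳 h𝒵 (D := (∅ : Finset α)) _ _ (dbl m ∪ lev m 1) rfl hKs (disjoint_empty_left _)
  set bb : α → ℤ := fun d => if insert d {a, b} ∈ 𝒳 ∧ insert d {a, b} ∈ 𝒵 then 1 else 0 with hbb
  have hQd : (#((dbl m).filter fun d => insert d {a, b} ∈ 𝒳 ∧ insert d {a, b} ∈ 𝒵) : ℤ) = bb d₁ + bb d₂ + bb d₃ := by
    rw [← hsumD bb]; simp only [hbb]; rw [sum_boole]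
  have hR : 4 + (bb d₁ + bb d₂ + bb d₃) ≤ kapR 𝒳 𝒵 m := by rw [← hQd]; unfold kapR; linarith
  have hbb0 : ∀ d, 0 ≤ bb d := fun d => by simp only [hbb]; split_ifs <;> norm_num
  -- loops
  have hL1 : 3 * ((τ.choose 2 : ℕ) : ℤ) ≤ ∑ d ∈ dbl m, ∑ Q ∈ (lev m 1).powersetCard 2, kapL1 𝒳 𝒵 m d Q := by
    have := sum_le_sum fun d hd => sum_kapL1_ge_alpha h𝒳 h𝒵 hX3 hZ3 hD hd hDX hDZ (m := m)
    rw [sum_const, hD] at this; simpa [nsmul_eq_mul] using this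
  -- WC1 ≤ q₁+q₂+q₃ and caps
  have hqW : ∀ d, #(((lev m 1).powersetCard 2).filter fun Q => insert d Q ∈ W) ≤ #(qset 𝒳 𝒵 m d) := fun d =>
    card_le_card fun Q hQ => mem_filter.2 ⟨(mem_filter.1 hQ).1, hWsub _ (mem_filter.1 hQ).2⟩
  have hWC1 : (#((W.filter fun w => ind w ≤ m).filter fun w => #(dbl m ∩ w) = 1) : ℤ) ≤
      #(qset 𝒳 𝒵 m d₁) + #(qset 𝒳 𝒵 m d₂) + #(qset 𝒳 𝒵 m d₃) := by
    have h1 := (card_WC1_le_sum hm W hW3).trans (sum_le_sum fun d (_ : d ∈ dbl m) => hqW d)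
    rw [hsumDn] at h1; exact_mod_cast h1
  have hcap : ∀ d, (#(qset 𝒳 𝒵 m d) : ℤ) + 1 ≤ (τ.choose 2 : ℕ) + bb d := fun d => by
    have := card_qset_le (𝒳 := 𝒳) (𝒵 := 𝒵) (m := m) d haT hbT hab
    simp only [hbb]; split_ifs with h
    · rw [if_pos h] at this; exact_mod_cast this
    · rw [if_neg h] at this; exact_mod_cast this
  -- WC2 ≤ γ₁+γ₂+γ₃
  have hWC2 : (#((W.filter fun w => ind w ≤ m).filter fun w => #(dbl m ∩ w) = 2) : ℤ) ≤
      (cE 𝒳 𝒵 m d₁ : ℤ) + cE 𝒳 𝒵 m d₂ + cE 𝒳 𝒵 m d₃ := by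
    have h1 := card_WC2_le_sum_cE hm hD W hW3 hWsub (𝒳 := 𝒳) (𝒵 := 𝒵)
    rw [hsumDn] at h1; exact_mod_cast h1
  have hγle : ∀ d, (cE 𝒳 𝒵 m d : ℤ) ≤ τ := fun d => by unfold cE; exact_mod_cast card_filter_le _ _
  -- constants
  have hΓ : 2 * (cH 3 (τ + 3) : ℤ) = (τ : ℤ) ^ 2 + 7 * τ + 14 := by
    have := two_mul_cH_three (n := τ + 3) (by omega); push_cast at this; linarith
  have hT2 : 2 * ((τ.choose 2 : ℕ) : ℤ) = (τ : ℤ) ^ 2 - τ := by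
    have h2 : τ.choose 2 * 2 = τ * (τ - 1) := by
      rw [Nat.choose_two_right]; exact Nat.div_mul_cancel (Nat.even_mul_pred_self τ).two_dvd
    have h1 : 1 ≤ τ := by omega
    have := congrArg (fun k : ℕ => (k : ℤ)) h2
    push_cast [Nat.cast_sub h1] at this
    linarith
  -- triangle facts
  have htri₁ : 2 ≤ #(csetL2 𝒳 𝒵 m d₁ d₂ ∩ csetL2 𝒳 𝒵 m d₁ d₃) → (τ : ℤ) * (τ + 2) ≤ ∑ y₀ ∈ lev m 1, kapL2 𝒳 𝒵 m d₁ y₀ :=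
    fun h => sum_kapL2_ge_tri h𝒳 h𝒵 hX3 hZ3 hD hd₁ he₁₂ he₁₃ h23 hDX hDZ h
  have htri₂ : 2 ≤ #(csetL2 𝒳 𝒵 m d₂ d₁ ∩ csetL2 𝒳 𝒵 m d₂ d₃) → (τ : ℤ) * (τ + 2) ≤ ∑ y₀ ∈ lev m 1, kapL2 𝒳 𝒵 m d₂ y₀ :=
    fun h => sum_kapL2_ge_tri h𝒳 h𝒵 hX3 hZ3 hD hd₂ he₂₁ he₂₃ h13 hDX hDZ h
  have htri₃ : 2 ≤ #(csetL2 𝒳 𝒵 m d₃ d₁ ∩ csetL2 𝒳 𝒵 m d₃ d₂) → (τ : ℤ) * (τ + 2) ≤ ∑ y₀ ∈ lev m 1, kapL2 𝒳 𝒵 m d₃ y₀ :=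
    fun h => sum_kapL2_ge_tri h𝒳 h𝒵 hX3 hZ3 hD hd₃ he₃₁ he₃₂ h12 hDX hDZ h
  -- ψ₁ facts: family d₁ sees γ₂ (via x = d₃) and γ₃ (via x = d₂), etc.
  have hc₁₂ : (#(csetL2 𝒳 𝒵 m d₁ d₂) : ℤ) = cE 𝒳 𝒵 m d₃ := by rw [card_csetL2_eq_cE hD hd₁ hd₂ hd₃ h12 h13 h23]
  have hc₁₃ : (#(csetL2 𝒳 𝒵 m d₁ d₃) : ℤ) = cE 𝒳 𝒵 m d₂ := by rw [card_csetL2_eq_cE hD hd₁ hd₃ hd₂ h13 h12 h23.symm]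
  have hc₂₁ : (#(csetL2 𝒳 𝒵 m d₂ d₁) : ℤ) = cE 𝒳 𝒵 m d₃ := by rw [card_csetL2_eq_cE hD hd₂ hd₁ hd₃ h12.symm h23 h13]
  have hc₂₃ : (#(csetL2 𝒳 𝒵 m d₂ d₃) : ℤ) = cE 𝒳 𝒵 m d₁ := by rw [card_csetL2_eq_cE hD hd₂ hd₃ hd₁ h23 h12.symm h13.symm]
  have hc₃₁ : (#(csetL2 𝒳 𝒵 m d₃ d₁) : ℤ) = cE 𝒳 𝒵 m d₂ := by rw [card_csetL2_eq_cE hD hd₃ hd₁ hd₂ h13.symm h23.symm h12]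
  have hc₃₂ : (#(csetL2 𝒳 𝒵 m d₃ d₂) : ℤ) = cE 𝒳 𝒵 m d₁ := by rw [card_csetL2_eq_cE hD hd₃ hd₂ hd₁ h23.symm h13.symm h12.symm]
  have hτ4 : 4 ≤ #(lev m 1) := by omega
  have hpsi₁₃ := psi_family_bound h𝒳 h𝒵 hX3 hZ3 hD hτ4 hd₁ he₁₂ hDX hDZ
  have hpsi₁₂ := psi_family_bound h𝒳 h𝒵 hX3 hZ3 hD hτ4 hd₁ he₁₃ hDX hDZ
  have hpsi₂₃ := psi_family_bound h𝒳 h𝒵 hX3 hZ3 hD hτ4 hd₂ he₂₁ hDX hDZ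
  have hpsi₂₁ := psi_family_bound h𝒳 h𝒵 hX3 hZ3 hD hτ4 hd₂ he₂₃ hDX hDZ
  have hpsi₃₂ := psi_family_bound h𝒳 h𝒵 hX3 hZ3 hD hτ4 hd₃ he₃₁ hDX hDZ
  have hpsi₃₁ := psi_family_bound h𝒳 h𝒵 hX3 hZ3 hD hτ4 hd₃ he₃₂ hDX hDZ
  rw [hc₁₂] at hpsi₁₃; rw [hc₁₃] at hpsi₁₂; rw [hc₂₁] at hpsi₂₃; rw [hc₂₃] at hpsi₂₁; rw [hc₃₁] at hpsi₃₂; rw [hc₃₂] at hpsi₃₁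
  -- pair facts (x ≤ 1)
  have hsubT : ∀ d x, csetL2 𝒳 𝒵 m d x ⊆ lev m 1 := fun d x => filter_subset _ _
  have hpair₁ : ¬ 2 ≤ #(csetL2 𝒳 𝒵 m d₁ d₂ ∩ csetL2 𝒳 𝒵 m d₁ d₃) → (cE 𝒳 𝒵 m d₃ : ℤ) + cE 𝒳 𝒵 m d₂ ≤ τ + 1 := fun h => by
    have := card_add_card_le_of_inter_le_one (hsubT d₁ d₂) (hsubT d₁ d₃) (by omega)
    rw [← hc₁₂, ← hc₁₃]; exact_mod_cast this
  have hpair₂ : ¬ 2 ≤ #(csetL2 𝒳 𝒵 m d₂ d₁ ∩ csetL2 𝒳 𝒵 m d₂ d₃) → (cE 𝒳 𝒵 m d₃ : ℤ) + cE 𝒳 𝒵 m d₁ ≤ τ + 1 := fun h => by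
    have := card_add_card_le_of_inter_le_one (hsubT d₂ d₁) (hsubT d₂ d₃) (by omega)
    rw [← hc₂₁, ← hc₂₃]; exact_mod_cast this
  have hpair₃ : ¬ 2 ≤ #(csetL2 𝒳 𝒵 m d₃ d₁ ∩ csetL2 𝒳 𝒵 m d₃ d₂) → (cE 𝒳 𝒵 m d₂ : ℤ) + cE 𝒳 𝒵 m d₁ ≤ τ + 1 := fun h => by
    have := card_add_card_le_of_inter_le_one (hsubT d₃ d₁) (hsubT d₃ d₂) (by omega)
    rw [← hc₃₁, ← hc₃₂]; exact_mod_cast this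
  -- inclusion–exclusion for k₀ = 3
  have hIE : ¬ 2 ≤ #(csetL2 𝒳 𝒵 m d₁ d₂ ∩ csetL2 𝒳 𝒵 m d₁ d₃) → ¬ 2 ≤ #(csetL2 𝒳 𝒵 m d₂ d₁ ∩ csetL2 𝒳 𝒵 m d₂ d₃) →
      ¬ 2 ≤ #(csetL2 𝒳 𝒵 m d₃ d₁ ∩ csetL2 𝒳 𝒵 m d₃ d₂) →
      (cE 𝒳 𝒵 m d₁ : ℤ) + cE 𝒳 𝒵 m d₂ + cE 𝒳 𝒵 m d₃ ≤ τ + 3 := fun h1 h2 h3 => by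
    have e32 : csetL2 𝒳 𝒵 m d₃ d₂ = csetL2 𝒳 𝒵 m d₂ d₃ := by
      rw [csetL2_eq_filter_erase hD hd₃ hd₂ hd₁ h23.symm h13.symm h12.symm, csetL2_eq_filter_erase hD hd₂ hd₃ hd₁ h23 h12.symm h13.symm]
    have e31 : csetL2 𝒳 𝒵 m d₃ d₁ = csetL2 𝒳 𝒵 m d₁ d₃ := by
      rw [csetL2_eq_filter_erase hD hd₃ hd₁ hd₂ h13.symm h23.symm h12, csetL2_eq_filter_erase hD hd₁ hd₃ hd₂ h13 h12 h23.symm]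
    have e21 : csetL2 𝒳 𝒵 m d₂ d₁ = csetL2 𝒳 𝒵 m d₁ d₂ := by
      rw [csetL2_eq_filter_erase hD hd₂ hd₁ hd₃ h12.symm h23 h13, csetL2_eq_filter_erase hD hd₁ hd₂ hd₃ h12 h13 h23]
    have hAB : #(csetL2 𝒳 𝒵 m d₂ d₃ ∩ csetL2 𝒳 𝒵 m d₁ d₃) ≤ 1 := by rw [← e32, ← e31, inter_comm]; omega
    have hAC : #(csetL2 𝒳 𝒵 m d₂ d₃ ∩ csetL2 𝒳 𝒵 m d₁ d₂) ≤ 1 := by rw [← e21, inter_comm]; omega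
    have hBC : #(csetL2 𝒳 𝒵 m d₁ d₃ ∩ csetL2 𝒳 𝒵 m d₁ d₂) ≤ 1 := by rw [inter_comm]; omega
    have := card_three_le_of_pairwise (hsubT d₂ d₃) (hsubT d₁ d₃) (hsubT d₁ d₂) hAB hAC hBC
    rw [← hc₂₃, ← hc₁₃, ← hc₁₂]; exact_mod_cast this
  -- make the data opaque and dispatch
  rw [hsumD fun d => ∑ y₀ ∈ lev m 1, kapL2 𝒳 𝒵 m d y₀]
  generalize hGL₁ : ∑ y₀ ∈ lev m 1, kapL2 𝒳 𝒵 m d₁ y₀ = L₁ at htri₁ hpsi₁₃ hpsi₁₂ ⊢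
  generalize hGL₂ : ∑ y₀ ∈ lev m 1, kapL2 𝒳 𝒵 m d₂ y₀ = L₂ at htri₂ hpsi₂₃ hpsi₂₁ ⊢
  generalize hGL₃ : ∑ y₀ ∈ lev m 1, kapL2 𝒳 𝒵 m d₃ y₀ = L₃ at htri₃ hpsi₃₂ hpsi₃₁ ⊢
  generalize hGL1 : ∑ d ∈ dbl m, ∑ Q ∈ (lev m 1).powersetCard 2, kapL1 𝒳 𝒵 m d Q = L1 at hL1 ⊢
  generalize hGκ : kapR 𝒳 𝒵 m = κR at hR ⊢
  generalize hGγ₁ : (cE 𝒳 𝒵 m d₁ : ℤ) = γ₁ at hWC2 hγle hpsi₂₁ hpsi₃₁ hpair₂ hpair₃ hIE ⊢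
  generalize hGγ₂ : (cE 𝒳 𝒵 m d₂ : ℤ) = γ₂ at hWC2 hpsi₁₂ hpsi₃₂ hpair₁ hpair₃ hIE ⊢
  generalize hGγ₃ : (cE 𝒳 𝒵 m d₃ : ℤ) = γ₃ at hWC2 hpsi₁₃ hpsi₂₃ hpair₁ hpair₂ hIE ⊢
  have hγ₁ : γ₁ ≤ τ := by rw [← hGγ₁]; exact_mod_cast card_filter_le _ _
  have hγ₂ : γ₂ ≤ τ := by rw [← hGγ₂]; exact_mod_cast card_filter_le _ _
  have hγ₃ : γ₃ ≤ τ := by rw [← hGγ₃]; exact_mod_cast card_filter_le _ _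
  generalize hGq₁ : (#(qset 𝒳 𝒵 m d₁) : ℤ) = q₁ at hWC1 hcap hpsi₁₃ hpsi₁₂ ⊢
  have hcap₁ : q₁ + 1 ≤ (τ.choose 2 : ℕ) + bb d₁ := by rw [← hGq₁]; exact hcap d₁
  generalize hGq₂ : (#(qset 𝒳 𝒵 m d₂) : ℤ) = q₂ at hWC1 hpsi₂₃ hpsi₂₁ ⊢
  have hcap₂ : q₂ + 1 ≤ (τ.choose 2 : ℕ) + bb d₂ := by rw [← hGq₂]; exact hcap d₂
  generalize hGq₃ : (#(qset 𝒳 𝒵 m d₃) : ℤ) = q₃ at hWC1 hpsi₃₂ hpsi₃₁ ⊢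
  have hcap₃ : q₃ + 1 ≤ (τ.choose 2 : ℕ) + bb d₃ := by rw [← hGq₃]; exact hcap d₃
  generalize hGW1 : (#((W.filter fun w => ind w ≤ m).filter fun w => #(dbl m ∩ w) = 1) : ℤ) = WC1 at hWC1 ⊢
  generalize hGW2 : (#((W.filter fun w => ind w ≤ m).filter fun w => #(dbl m ∩ w) = 2) : ℤ) = WC2 at hWC2 ⊢
  generalize hGT2 : ((τ.choose 2 : ℕ) : ℤ) = T2 at hL1 hT2 hcap₁ hcap₂ hcap₃ ⊢
  generalize hGΓ : (cH 3 (τ + 3) : ℤ) = Γ at hΓ ⊢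
  generalize hGτ : (τ : ℤ) = τz at *
  have hτz : (18 : ℤ) ≤ τz := by rw [← hGτ]; exact_mod_cast hτ
  have hΓ' : 2 * Γ = τz ^ 2 + 7 * τz + 14 := hΓ
  -- goal: Γ + (τz+2)·WC2 + WC1 ≤ κR + (L₁+L₂+L₃) + L1
  have key : 2 * Γ + 2 * (τz + 2) * WC2 + 2 * WC1 ≤ 2 * (κR + (L₁ + L₂ + L₃) + L1) := by
    by_cases hx₁ : 2 ≤ #(csetL2 𝒳 𝒵 m d₁ d₂ ∩ csetL2 𝒳 𝒵 m d₁ d₃) <;>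
    by_cases hx₂ : 2 ≤ #(csetL2 𝒳 𝒵 m d₂ d₁ ∩ csetL2 𝒳 𝒵 m d₂ d₃) <;>
    by_cases hx₃ : 2 ≤ #(csetL2 𝒳 𝒵 m d₃ d₁ ∩ csetL2 𝒳 𝒵 m d₃ d₂)
    · exact absurd ⟨hx₁, hx₂, hx₃⟩ hall
    · -- TRI TRI DEG
      exact rowThree_arith_k1 hτz hR hL1 hWC1 hWC2 hΓ' hT2 le_rfl (hbb0 d₃) hγ₃ (htri₁ hx₁) hcap₁ (htri₂ hx₂) hcap₂
        hpsi₃₁ hpsi₃₂ (by linarith [hpair₃ hx₃])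
    · -- TRI DEG TRI: lemma families (1,2,3) := ours (1,3,2); lemma γ := (γ₁, γ₃, γ₂)
      have := rowThree_arith_k1 (L₁ := L₁) (L₂ := L₃) (L₃ := L₂) (q₁ := q₁) (q₂ := q₃) (q₃ := q₂) (γ₁ := γ₁) (γ₂ := γ₃) (γ₃ := γ₂)
        (b₁ := bb d₁) (b₂ := bb d₃) (b₃ := bb d₂) (Qd := bb d₁ + bb d₂ + bb d₃) (WC1 := WC1) (WC2 := WC2)
        hτz hR hL1 (by linarith) (by linarith) hΓ' hT2 (by linarith) (hbb0 d₂) hγ₂ (htri₁ hx₁) hcap₁ (htri₃ hx₃) hcap₃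
        hpsi₂₁ hpsi₂₃ (by linarith [hpair₂ hx₂])
      linarith
    · -- TRI DEG DEG: k2 direct
      have := rowThree_arith_k2 (Qd := bb d₁ + bb d₂ + bb d₃) (by linarith) hR hL1 hWC1 hWC2 hΓ' hT2 le_rfl (hbb0 d₂) (hbb0 d₃)
        hγ₂ hγ₃ (htri₁ hx₁) hcap₁ hpsi₂₃ (by linarith [hpair₂ hx₂]) hpsi₃₂ (by linarith [hpair₃ hx₃])
      linarith
    · -- DEG TRI TRI: lemma families (1,2,3) := ours (2,3,1); γ := (γ₂, γ₃, γ₁)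
      have := rowThree_arith_k1 (L₁ := L₂) (L₂ := L₃) (L₃ := L₁) (q₁ := q₂) (q₂ := q₃) (q₃ := q₁) (γ₁ := γ₂) (γ₂ := γ₃) (γ₃ := γ₁)
        (b₁ := bb d₂) (b₂ := bb d₃) (b₃ := bb d₁) (Qd := bb d₁ + bb d₂ + bb d₃) (WC1 := WC1) (WC2 := WC2)
        hτz hR hL1 (by linarith) (by linarith) hΓ' hT2 (by linarith) (hbb0 d₁) hγ₁ (htri₂ hx₂) hcap₂ (htri₃ hx₃) hcap₃
        hpsi₁₂ hpsi₁₃ (by linarith [hpair₁ hx₁])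
      linarith
    · -- DEG TRI DEG: k2 with lemma family 1 := ours 2 (γ not seen: γ₂); lemma 2 := ours 1 (psi γ₃, pair γ₂+γ₃); lemma 3 := ours 3 (psi γ₁)
      have := rowThree_arith_k2 (L₁ := L₂) (L₂ := L₁) (L₃ := L₃) (q₁ := q₂) (q₂ := q₁) (q₃ := q₃) (γ₁ := γ₂) (γ₂ := γ₁) (γ₃ := γ₃)
        (b₁ := bb d₂) (b₂ := bb d₁) (b₃ := bb d₃) (Qd := bb d₁ + bb d₂ + bb d₃) (WC1 := WC1) (WC2 := WC2)
        (by linarith) hR hL1 (by linarith) (by linarith) hΓ' hT2 (by linarith) (hbb0 d₁) (hbb0 d₃) hγ₁ hγ₃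
        (htri₂ hx₂) hcap₂ hpsi₁₃ (by linarith [hpair₁ hx₁]) hpsi₃₁ (by linarith [hpair₃ hx₃])
      linarith
    · -- DEG DEG TRI: k2 with lemma family 1 := ours 3 (γ₃); lemma 2 := ours 1 (psi γ₂, pair γ₃+γ₂); lemma 3 := ours 2 (psi γ₁, pair γ₃+γ₁)
      have := rowThree_arith_k2 (L₁ := L₃) (L₂ := L₁) (L₃ := L₂) (q₁ := q₃) (q₂ := q₁) (q₃ := q₂) (γ₁ := γ₃) (γ₂ := γ₁) (γ₃ := γ₂)
        (b₁ := bb d₃) (b₂ := bb d₁) (b₃ := bb d₂) (Qd := bb d₁ + bb d₂ + bb d₃) (WC1 := WC1) (WC2 := WC2)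
        (by linarith) hR hL1 (by linarith) (by linarith) hΓ' hT2 (by linarith) (hbb0 d₁) (hbb0 d₂) hγ₁ hγ₂
        (htri₃ hx₃) hcap₃ hpsi₁₂ (by linarith [hpair₁ hx₁]) hpsi₂₁ (by linarith [hpair₂ hx₂])
      linarith
    · -- DEG DEG DEG
      have := rowThree_arith_k3 (Qd := bb d₁ + bb d₂ + bb d₃) (by linarith) hR (by linarith [hbb0 d₁, hbb0 d₂, hbb0 d₃]) hL1 hWC1 hWC2
        hΓ' hT2 hpsi₁₂ hpsi₂₃ hpsi₃₁ (hIE hx₁ hx₂ hx₃)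
      linarith
  linarith [key]

end RowThreeCaseII

end Summit.CriticalPhenomena.PercolationContinuityZ3.Theorems.SahiCTCForms
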